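import Summits.HodgeConjecture.HodgeConjecture.Theorems.R90S10ArchTransferSignsOfArchKit   -- ★ S10 kit: `archDeltaPP`, `IsArchEndoCharId`, `IsArchStablyNull`, `ArchCompatibleFamiliesH`, (W)(C) tokens
import Summits.HodgeConjecture.HodgeConjecture.Theorems.R90S2TensorRepLetterDefs          -- ★ p864621 ℓ3: `HasLocalComponents` (+ ★ `archTensor`, `CuspH₀`, `AreUnitarilyEquivalent`)
import Summits.HodgeConjecture.HodgeConjecture.Theorems.R90S2ArchBlockPacketLetterDefs     -- ★ ℓ1′ (R90-C11-typ2): `BlockPacketData` (full local packet `Fin 3`, signs `sgn`, members `bpos bneg`)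
import HarnessLib

/-!
# R90-TF ∕ S2 «Ch. 12 archimedean block» — `R90S2ArchBlockPacketEndoscopyLetterDefs`: LETTERS-DEFS part ℓT2-E (v2, FULL LOCAL PACKETS) — the global-archimedean
# ENDOSCOPY LETTER `ArchBlockPacketEndoscopyLetter L μ S` for tensor families of members of the full block packets `Π(ρ_w) = {π_{1w}, π_{2w}, π_{3w}}`, in T2's frame

Cell `pub/hodgecm-mathlib`, Track B ∕ R90-TF, section S2, crux h413 = `stmt-HodgeConjecture-24833`, route `HCCMUnconditional`.  Typed by K2E4-p23 (g4) on S2 desk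
K2E1b-plan (g8)'s RULING R-S2-E1 2026-09-05T03:01:08Z (audit E-1 of R90-C11-audit1 (g2) ACCEPTED): print's local `L`-packets have THREE members (p. 218 L11–14:
`Π(ρ_v) = {π_{1v}, π_{2v}, π_{3v}}`, `Tr ρ_v(f_v^H) = Σ_{1≤j≤3} ⟨ρ_v, π_{jv}⟩ Tr π_{jv}(f_v)`), and ★ `IsArchEndoCharId` quantifies over EVERY matched test pair, so the
letter must index tensor families by the FULL packet `Fin 3` at every place — this file SUPERSEDES the two-member form ★ `R90S2ArchPacketEndoscopyLetterDefs`
(`ArchPacketEndoscopyLetter`, indexed by `Bool`; dead as a socket, never registered).  §1 = the dealer's PROBE `PROBE-LETTERS-LT2E-Endoscopy.v1` c0b78bcc §1 with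
EXACTLY the ruling's delta: carrier ★ ℓ1′ `BlockPacketData (Fin 3)` (fields `E instNACG instIPS instCS π hu hsc … φ … sgn bpos bneg`), `EG : (places → Fin 3) → Type`,
signs `∏_w (d w).sgn (k w)`, the one-place difference at the two signed members `bpos ∕ bneg`.

WHAT IS DEFINED (ONE closed-shape parametrised `Prop` + `Iff.rfl`; NO socket, NO instance, NO notation, NO `sorry`; nothing asserted).
`ArchBlockPacketEndoscopyLetter L μ S` — in T2's frame VERBATIM (`R90.S2.stub_R90_S2_archBlockPacketCusp`, D ED. 2 :90–:126: right-invariant Haar `ν, νH` on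
`G_∞ = U(Φ₃)(L ⊗ ℝ)`, `H_∞`; Borel `letI`s on the orbit quotients; families `mH, mG`, centraliser Haar families `tH, t`; (W) `mG.IsQuotientOf (IsRegularElt ·) ν t`; (C) the
★ `archStableCentralizerEquiv` transport of `t`; ★ `ArchCompatibleFamiliesH`; ★ `IsArchNondegenerate`; ★ `IsArchDeltaTransferExists`), for EVERY family of local Haar measures
`νw` matching `ν` along ★ `archPiEquivCM`: THERE IS full-packet data `d w : BlockPacketData (Fin 3) (U(σ_w Φ₃)(ℂ)) (νw w) (S w)` at every complex place `w` (three
inequivalent irreducible unitary square-integrable members, dual pseudo-coefficients, signs `sgn` with `sgn bpos = 1`, `sgn bneg = −1`; print p. 218 L11–20) such that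
* (E1) every tensor family `ϖ k`, `k : places → Fin 3`, with local components `(d w).π (k w)` (★ ℓ3 `HasLocalComponents`) satisfies the archimedean endoscopic
  character identity ★ `IsArchEndoCharId` with signs `s k = ∏_w (d w).sgn (k w)` and SOME unitary `ρ_∞` of `H_∞` (Prop. 12.3.2 ⊗ places, all three members);
* (E2) for every place `u`, the one-place difference tensor `⊗_{w ≠ u} φ_w^{bpos} ⊗ (φ_u^{bpos} − φ_u^{bneg})` is ★ `IsArchStablyNull` for `mG` (p. 218 L20–21);
* (E3) for every place `u`, that tensor has an ★ `ArchSmooth₂` `Δ″_∞`-transfer `fH` (★ `IsArchDeltaTransfer`) that is ★ `CuspH₀` at every `ι` (p. 218 L22–25).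
A LETTER: the hypothesis shape the assembly CARD 8 (v2) consumes BY NAME; payment = CLOSURE-row archimedean representation theory — not attempted in S2 this rung.

HONEST LABEL: a parametrised `Prop` asserts nothing and pays nothing; HC_CM is proved only modulo the 7 printed citations (2 remaining named inputs: hLiu418 =
stmt-HodgeConjecture-24832, h413 = stmt-HodgeConjecture-24833) until rung 0 closes.  Count-neutral (`--supports stmt-HodgeConjecture-24833`).

References (print): Rogawski 1990 §13.8 p. 218 L11–25, §12.3 Prop. 12.3.2 ∕ 12.3.3 p. 178; Shelstad 1979 Lemma 5.3; Arthur 1988 (Invariant trace formula II) §7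
p. 538; Clozel–Delorme 1984 Thm. 1.
-/

set_option autoImplicit false
set_option linter.dupNamespace false

noncomputable section

open NumberField NumberField.InfinitePlace MeasureTheory CompactlySupported
open scoped Matrix MatrixGroups InnerProductSpace

namespace Summit.HodgeConjecture.HodgeConjecture.R90.S2

open Literature.NumberTheory.Automorphic Literature.NumberTheory.Automorphic.UnitaryGroup
open Literature.NumberTheory.Rogawski1990
open Literature.NumberTheory.GaloisRepresentations (HeckeCharacter)
open Summit.HodgeConjecture.HodgeConjecture.Cruxes.H413.K2E1bGKCohomologyU21.U8 (HasArchOpTrace)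
open Summit.HodgeConjecture.HodgeConjecture.R90.S10 (GInf HInf phi3 archDeltaPP IsArchEndoCharId IsArchStablyNull)

/-! ## §1 «ℓT2-E» (v2) — the global-archimedean ENDOSCOPY LETTER for tensor families of full local packets -/

section Letter

variable (L : Type) [Field L] [NumberField L] [IsCMField L]

open scoped Classical in
/-- **«ℓT2-E» (v2, full packets) — the global-archimedean ENDOSCOPY LETTER** for tensor families of members of the full local packets, in T2's frame
VERBATIM (measures `ν, νH`, families `mH, mG, tH, t`, (W), (C), ★ `ArchCompatibleFamiliesH`, non-degeneracy, transfer existence): for every family of local Haar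
measures `νw` matching `ν` along ★ `archPiEquivCM` there is full-packet data `d w` (★ ℓ1′ `BlockPacketData (Fin 3)`: three members, dual pseudo-coefficients, signs)
at every complex place with (E1) the endoscopic character identity ★ `IsArchEndoCharId` for EVERY tensor family of members `k : places → Fin 3` (signs
`∏_w (d w).sgn (k w)`, some unitary `ρ_∞` of `H_∞`), (E2) stable nullity ★ `IsArchStablyNull` of the one-place difference tensor at the signed members `bpos ∕ bneg`,
and (E3) an ★ `ArchSmooth₂` `Δ″_∞`-transfer of it that is ★ `CuspH₀` at every `ι`.  A closed-shape parametrised `Prop` (binders `μ`, `S`): nothing is asserted; the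
assembly consumes it by name; its payment is CLOSURE-row archimedean representation theory (print: Rogawski 1990 §13.8 p. 218 L11–25 and Prop. 12.3.2 ∕ 12.3.3
p. 178; Shelstad 1979 Lemma 5.3; Arthur 1988 §7 p. 538; Clozel–Delorme 1984) — the citation tokens ride on `archBlockPacketEndoscopyLetter_iff`. -/
def ArchBlockPacketEndoscopyLetter (μ : HeckeCharacter L)
    (S : ∀ w : {w : InfinitePlace L // w.IsComplex}, C_c(↥(archLocal L 3 (phi3 L) w), ℂ) → Prop) : Prop :=
  ∀ [MeasurableSpace (GInf L)] [BorelSpace (GInf L)] (ν : Measure (GInf L)) [ν.IsHaarMeasure] [ν.IsMulRightInvariant]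
    [MeasurableSpace (HInf L)] [BorelSpace (HInf L)] (νH : Measure (HInf L)) [νH.IsHaarMeasure] [νH.IsMulRightInvariant],
  letI : ∀ a : HInf L, MeasurableSpace (HInf L ⧸ Subgroup.centralizer ({a} : Set (HInf L))) := fun _ => borel _
  haveI : ∀ a : HInf L, BorelSpace (HInf L ⧸ Subgroup.centralizer ({a} : Set (HInf L))) := fun _ => ⟨rfl⟩
  letI : ∀ γ : GInf L, MeasurableSpace (GInf L ⧸ Subgroup.centralizer ({γ} : Set (GInf L))) := fun _ => borel _
  haveI : ∀ γ : GInf L, BorelSpace (GInf L ⧸ Subgroup.centralizer ({γ} : Set (GInf L))) := fun _ => ⟨rfl⟩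
  ∀ (mH : OrbitalMeasureFamily (HInf L)) (mG : OrbitalMeasureFamily (GInf L))
    (tH : ∀ a : HInf L, Measure (Subgroup.centralizer ({a} : Set (HInf L))))
    (t : ∀ γ : GInf L, Measure (Subgroup.centralizer ({γ} : Set (GInf L)))),
    mG.IsQuotientOf (fun γ => IsRegularElt (γ.val : GL (Fin 3) (mixedEmbedding.mixedSpace L))) ν t →
    (∀ (γ₁ γ₂ : GInf L)
        (h₁ : IsRegularElt (γ₁.val : GL (Fin 3) (mixedEmbedding.mixedSpace L)))
        (hc : Corresponds (UnitaryGroup.conjMixed (↥(maximalRealSubfield L)) L (IsCMField.complexConj L))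
          (UnitaryGroup.archFormOf L 3 (phi3 L)) (UnitaryGroup.archFormOf L 3 (phi3 L)) γ₁ γ₂),
        Measure.map ⇑(UnitaryGroup.archStableCentralizerEquiv L (UnitaryGroup.isUnit_antidiagOne_det L 3).ne_zero
          (UnitaryGroup.isUnit_antidiagOne_det L 3).ne_zero hc h₁) (t γ₁) = t γ₂) →
    ArchCompatibleFamiliesH L νH mH tH t →
    IsArchNondegenerate L (phi3 L) (archDeltaPP L μ) →
    IsArchDeltaTransferExists L (phi3 L) (archDeltaPP L μ) mH mG (ArchSmooth L 3 (phi3 L)) (ArchSmooth₂ L) →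
    ∀ [∀ w : {w : InfinitePlace L // w.IsComplex}, MeasurableSpace ↥(archLocal L 3 (phi3 L) w)]
      [∀ w : {w : InfinitePlace L // w.IsComplex}, BorelSpace ↥(archLocal L 3 (phi3 L) w)]
      (νw : ∀ w : {w : InfinitePlace L // w.IsComplex}, Measure ↥(archLocal L 3 (phi3 L) w))
      [∀ w, (νw w).IsHaarMeasure],
      ν.map ⇑(archPiEquivCM L (phi3 L) (N := 3)) = Measure.pi νw →
      ∃ d : ∀ w : {w : InfinitePlace L // w.IsComplex}, BlockPacketData (Fin 3) ↥(archLocal L 3 (phi3 L) w) (νw w) (S w),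
        -- (E1) endoscopic character identity for every tensor family of members
        (∀ (EG : ({w : InfinitePlace L // w.IsComplex} → Fin 3) → Type)
            [∀ k, NormedAddCommGroup (EG k)] [∀ k, InnerProductSpace ℂ (EG k)] [∀ k, CompleteSpace (EG k)]
            (ϖ : ∀ k, ContRepresentation ℂ (GInf L) (EG k)) (hu : ∀ k, (ϖ k).IsUnitary) (hsc : ∀ k, (ϖ k).IsStronglyContinuous),
            (∀ k, letI := fun w => (d w).instNACG (k w); letI := fun w => (d w).instIPS (k w); letI := fun w => (d w).instCS (k w)
              HasLocalComponents (archPiEquivCM L (phi3 L) (N := 3)) ν νw (ϖ k) (hu k) (hsc k)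
                (fun w => (d w).E (k w)) (fun w => (d w).π (k w)) (fun w => (d w).hu (k w)) (fun w => (d w).hsc (k w))) →
            ∃ (EH : Type) (_ : NormedAddCommGroup EH) (_ : InnerProductSpace ℂ EH) (_ : CompleteSpace EH)
              (ρ : ContRepresentation ℂ (HInf L) EH) (huH : ρ.IsUnitary) (hscH : ρ.IsStronglyContinuous),
              IsArchEndoCharId L (archDeltaPP L μ) mH mG ν νH EG ϖ hu hsc (fun k => ∏ w, (d w).sgn (k w)) ρ huH hscH) ∧
        -- (E2) + (E3) per place `u`: the one-place difference tensor is stably null and has a cuspidal smooth transfer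
        (∀ u : {w : InfinitePlace L // w.IsComplex},
          IsArchStablyNull L mG
              ⇑(archTensor L (phi3 L) (Function.update (fun w => (d w).φ (d w).bpos) u ((d u).φ (d u).bpos - (d u).φ (d u).bneg))) ∧
            ∃ fH : C_c(HInf L, ℂ), ArchSmooth₂ L ⇑fH ∧
              IsArchDeltaTransfer L (phi3 L) (archDeltaPP L μ) mH mG ⇑fH
                ⇑(archTensor L (phi3 L) (Function.update (fun w => (d w).φ (d w).bpos) u ((d u).φ (d u).bpos - (d u).φ (d u).bneg))) ∧
              ∀ ι : L →+* ℂ, CuspH₀ L mH ι ⇑fH)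

open scoped Classical in
/-- Unfolding of `ArchBlockPacketEndoscopyLetter` (definitional): the global-archimedean endoscopy letter for tensor families of members of the FULL local packets
`Π(ρ_w) = {π_{1w}, π_{2w}, π_{3w}}`, in T2's frame — (E1) the endoscopic character identity of Prop. 12.3.2 tensored over the complex places with the signs
`⟨ρ_v, π_{jv}⟩ ∈ {±1}` of the chosen integrable `ρ` («not all equal»), (E2) stable nullity of the one-place differences of the pseudo-coefficients of the two signed
members, (E3) their smooth cuspidal `Δ″_∞`-transfers («`f^H` a linear combination of pseudo-coefficients on `H`»).
[cite: Rogawski1990, §13.8 p. 218 L11–25; §12.3 Prop. 12.3.2 p. 178] [cite: Shelstad1979, L. 5.3] [cite: Arthur1988InvariantTraceFormulaII, §7 p. 538] [cite: ClozelDelorme1984] -/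
theorem archBlockPacketEndoscopyLetter_iff (μ : HeckeCharacter L)
    (S : ∀ w : {w : InfinitePlace L // w.IsComplex}, C_c(↥(archLocal L 3 (phi3 L) w), ℂ) → Prop) :
    ArchBlockPacketEndoscopyLetter L μ S ↔
      ∀ [MeasurableSpace (GInf L)] [BorelSpace (GInf L)] (ν : Measure (GInf L)) [ν.IsHaarMeasure] [ν.IsMulRightInvariant]
        [MeasurableSpace (HInf L)] [BorelSpace (HInf L)] (νH : Measure (HInf L)) [νH.IsHaarMeasure] [νH.IsMulRightInvariant],
      letI : ∀ a : HInf L, MeasurableSpace (HInf L ⧸ Subgroup.centralizer ({a} : Set (HInf L))) := fun _ => borel _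
      haveI : ∀ a : HInf L, BorelSpace (HInf L ⧸ Subgroup.centralizer ({a} : Set (HInf L))) := fun _ => ⟨rfl⟩
      letI : ∀ γ : GInf L, MeasurableSpace (GInf L ⧸ Subgroup.centralizer ({γ} : Set (GInf L))) := fun _ => borel _
      haveI : ∀ γ : GInf L, BorelSpace (GInf L ⧸ Subgroup.centralizer ({γ} : Set (GInf L))) := fun _ => ⟨rfl⟩
      ∀ (mH : OrbitalMeasureFamily (HInf L)) (mG : OrbitalMeasureFamily (GInf L))
        (tH : ∀ a : HInf L, Measure (Subgroup.centralizer ({a} : Set (HInf L))))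
        (t : ∀ γ : GInf L, Measure (Subgroup.centralizer ({γ} : Set (GInf L)))),
        mG.IsQuotientOf (fun γ => IsRegularElt (γ.val : GL (Fin 3) (mixedEmbedding.mixedSpace L))) ν t →
        (∀ (γ₁ γ₂ : GInf L)
            (h₁ : IsRegularElt (γ₁.val : GL (Fin 3) (mixedEmbedding.mixedSpace L)))
            (hc : Corresponds (UnitaryGroup.conjMixed (↥(maximalRealSubfield L)) L (IsCMField.complexConj L))
              (UnitaryGroup.archFormOf L 3 (phi3 L)) (UnitaryGroup.archFormOf L 3 (phi3 L)) γ₁ γ₂),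
            Measure.map ⇑(UnitaryGroup.archStableCentralizerEquiv L (UnitaryGroup.isUnit_antidiagOne_det L 3).ne_zero
              (UnitaryGroup.isUnit_antidiagOne_det L 3).ne_zero hc h₁) (t γ₁) = t γ₂) →
        ArchCompatibleFamiliesH L νH mH tH t →
        IsArchNondegenerate L (phi3 L) (archDeltaPP L μ) →
        IsArchDeltaTransferExists L (phi3 L) (archDeltaPP L μ) mH mG (ArchSmooth L 3 (phi3 L)) (ArchSmooth₂ L) →
        ∀ [∀ w : {w : InfinitePlace L // w.IsComplex}, MeasurableSpace ↥(archLocal L 3 (phi3 L) w)]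
          [∀ w : {w : InfinitePlace L // w.IsComplex}, BorelSpace ↥(archLocal L 3 (phi3 L) w)]
          (νw : ∀ w : {w : InfinitePlace L // w.IsComplex}, Measure ↥(archLocal L 3 (phi3 L) w))
          [∀ w, (νw w).IsHaarMeasure],
          ν.map ⇑(archPiEquivCM L (phi3 L) (N := 3)) = Measure.pi νw →
          ∃ d : ∀ w : {w : InfinitePlace L // w.IsComplex}, BlockPacketData (Fin 3) ↥(archLocal L 3 (phi3 L) w) (νw w) (S w),
            (∀ (EG : ({w : InfinitePlace L // w.IsComplex} → Fin 3) → Type)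
                [∀ k, NormedAddCommGroup (EG k)] [∀ k, InnerProductSpace ℂ (EG k)] [∀ k, CompleteSpace (EG k)]
                (ϖ : ∀ k, ContRepresentation ℂ (GInf L) (EG k)) (hu : ∀ k, (ϖ k).IsUnitary) (hsc : ∀ k, (ϖ k).IsStronglyContinuous),
                (∀ k, letI := fun w => (d w).instNACG (k w); letI := fun w => (d w).instIPS (k w); letI := fun w => (d w).instCS (k w)
                  HasLocalComponents (archPiEquivCM L (phi3 L) (N := 3)) ν νw (ϖ k) (hu k) (hsc k)
                    (fun w => (d w).E (k w)) (fun w => (d w).π (k w)) (fun w => (d w).hu (k w)) (fun w => (d w).hsc (k w))) →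
                ∃ (EH : Type) (_ : NormedAddCommGroup EH) (_ : InnerProductSpace ℂ EH) (_ : CompleteSpace EH)
                  (ρ : ContRepresentation ℂ (HInf L) EH) (huH : ρ.IsUnitary) (hscH : ρ.IsStronglyContinuous),
                  IsArchEndoCharId L (archDeltaPP L μ) mH mG ν νH EG ϖ hu hsc (fun k => ∏ w, (d w).sgn (k w)) ρ huH hscH) ∧
            (∀ u : {w : InfinitePlace L // w.IsComplex},
              IsArchStablyNull L mG
                  ⇑(archTensor L (phi3 L) (Function.update (fun w => (d w).φ (d w).bpos) u ((d u).φ (d u).bpos - (d u).φ (d u).bneg))) ∧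
                ∃ fH : C_c(HInf L, ℂ), ArchSmooth₂ L ⇑fH ∧
                  IsArchDeltaTransfer L (phi3 L) (archDeltaPP L μ) mH mG ⇑fH
                    ⇑(archTensor L (phi3 L) (Function.update (fun w => (d w).φ (d w).bpos) u ((d u).φ (d u).bpos - (d u).φ (d u).bneg))) ∧
                  ∀ ι : L →+* ℂ, CuspH₀ L mH ι ⇑fH) :=
  Iff.rfl

end Letter

end Summit.HodgeConjecture.HodgeConjecture.R90.S2

end
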